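import Literature.NumberTheory.Transcendental.PeriodsWave0
import HarnessLib

/-!
# Records (2020–2022): two irrational values among `ζ(5),…,ζ(35)`; one among `β(2),…,β(10)`

Topic `Literature/NumberTheory/Irrationality/LaiZhou2022`. Typed, cited statements (no proofs) of the
current RECORD "window" theorems that sharpen Zudilin's "one of `ζ(5), ζ(7), ζ(9), ζ(11)`" (tree:
`Literature.NumberTheory.Transcendental.zudilin`, PROVED as `zudilin_holds`) in the direction of pairs,
and the record for Dirichlet's beta values, from

* L. Lai, L. Zhou, *At least two of `ζ(5), ζ(7), …, ζ(35)` are irrational*, Publ. Math. Debrecen **101**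
  (2022) 353–372 = arXiv:2103.00904 [LaiZhou2021]: "Theorem 1.2. At least two of `ζ(5), ζ(7), …, ζ(35)`
  are irrational." and "Theorem 6.1. At least one of `β(2), β(4), β(6), β(8), β(10)` is irrational."
  (improving Rivoal–Zudilin 2003: `β(2),…,β(14)`, and Zudilin 2019, Theorem 1: `β(2),…,β(12)`);
* T. Rivoal, W. Zudilin, *A note on odd zeta values*, Sém. Lothar. Combin. **81** (2020) B81b =
  arXiv:1803.03160 [RivoalZudilin2020]: "Theorem 1. There exist at least two irrational numbers amongst
  the odd zeta values `ζ(5), ζ(7), …, ζ(69)`" — here DERIVED from Lai–Zhou's Theorem 1.2 (a window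
  containing `{5,…,35}`), `rivoalZudilin2020_of_laiZhou`.

HONEST FRAMING (cell pub-zeta5): systematic search; no irrationality claim unless certified. These are
the printed records against which FRESHNESS.md measures "progress on ζ(5)"; none of them isolates `ζ(5)`.
`ζ(k) = zetaValue k`, and `β(s) = betaValue s` with `betaValue 2 = catalanConstant` by `rfl`
(`betaValue_two`).

Not here: the asymptotic counting results (Fischler–Sprang–Zudilin 2019, Lai–Yu 2020, Fischler 2021,
Lai 2025) and the proofs (saddle-point method on Zudilin-type very-well-poised forms with `Φₙ` factors).
-/

noncomputable section

namespace Literature.NumberTheory.Irrationality.LaiZhou2022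

open Literature.NumberTheory.Transcendental (zetaValue catalanConstant)

/-- Dirichlet's beta values `β(s) = ∑_{k ≥ 0} (−1)ᵏ/(2k+1)ˢ` for natural `s` (as a real `tsum`; for
`s = 0` the series diverges and the value is Mathlib's junk `0`; for `s = 1` it converges only
conditionally and the `tsum` is again junk — only `s ≥ 2` is used). [cite: LaiZhou2021, §6 (definition of β)] -/
def betaValue (s : ℕ) : ℝ := ∑' n : ℕ, (-1) ^ n / ((2 * n + 1 : ℝ)) ^ s

/-- `β(2)` is the tree's Catalan constant (syntactically the same series). [cite: LaiZhou2021, §6 ("The constant β(2) is called Catalan's constant")] -/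
theorem betaValue_two : betaValue 2 = catalanConstant := rfl

/-- **Lai–Zhou, Theorem 1.2**: "At least two of `ζ(5), ζ(7), …, ζ(35)` are irrational" — there are two
distinct odd integers `i, j ∈ [5, 35]` with `ζ(i), ζ(j) ∉ ℚ`. Named fact (statement only).
[cite: LaiZhou2021, Theorem 1.2] -/
def twoOf_zeta5_to_zeta35 : Prop :=
  ∃ i j : ℕ, i ≠ j ∧ Odd i ∧ Odd j ∧ 5 ≤ i ∧ i ≤ 35 ∧ 5 ≤ j ∧ j ≤ 35 ∧
    Irrational (zetaValue i) ∧ Irrational (zetaValue j)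

/-- **Lai–Zhou, Theorem 6.1**: "At least one of `β(2), β(4), β(6), β(8), β(10)` is irrational." Named fact
(statement only); the record for even beta values (Rivoal–Zudilin 2003: up to `β(14)`; Zudilin 2019: up to
`β(12)`). [cite: LaiZhou2021, Theorem 6.1] -/
def oneOf_beta2_to_beta10 : Prop :=
  Irrational (betaValue 2) ∨ Irrational (betaValue 4) ∨ Irrational (betaValue 6) ∨
    Irrational (betaValue 8) ∨ Irrational (betaValue 10)

/-- **Rivoal–Zudilin 2020, Theorem 1**: "There exist at least two irrational numbers amongst the odd zeta
values `ζ(5), ζ(7), …, ζ(69)`" — derived here from Lai–Zhou's Theorem 1.2 (the window `[5,35]` lies in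
`[5,69]`). [cite: RivoalZudilin2020, Theorem 1] -/
theorem rivoalZudilin2020_of_laiZhou (h : twoOf_zeta5_to_zeta35) :
    ∃ i j : ℕ, i ≠ j ∧ Odd i ∧ Odd j ∧ 5 ≤ i ∧ i ≤ 69 ∧ 5 ≤ j ∧ j ≤ 69 ∧
      Irrational (zetaValue i) ∧ Irrational (zetaValue j) := by
  obtain ⟨i, j, hij, hi, hj, hi5, hi35, hj5, hj35, hzi, hzj⟩ := h
  exact ⟨i, j, hij, hi, hj, hi5, by omega, hj5, by omega, hzi, hzj⟩

/-- Lai–Zhou's Theorem 6.1 in terms of the tree's open statement: if Catalan's constant were the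
irrational one, `CatalanIrrational` would hold — recorded only as the trivial reading
`Irrational (betaValue 2) ↔ CatalanIrrational`. [cite: LaiZhou2021, §6] -/
theorem irrational_betaValue_two_iff :
    Irrational (betaValue 2) ↔ Literature.NumberTheory.Transcendental.CatalanIrrational := Iff.rfl

end Literature.NumberTheory.Irrationality.LaiZhou2022
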